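import Summits.CriticalPhenomena.PercolationContinuityZ3.Theorems.PercNearOneGluingNoHeavyQuantHeavyShift
import HarnessLib

/-!
# QUANT lane R8, T-DEC: the REFLECTION certificate `b ↔ M − b` at the floor gate — a law is HEAVY at `(x, T ≤ x·M)` as soon as
# `x·μ b ≤ (1−x)·μ (M−b)` on its low atoms (prim-quant-census-2 gen 81)

builds on p205010 (kernel theorem, internal audit signed; external expert review pending)

Support file (`--supports stmt-CriticalPhenomena-4575`), QUANT lane census seat prim-quant-census-2 (gen 81); memo
`run/shared/lean/prim/quant/prim-quant-census-2-g81/AFL-G81.md` §2.  Theorems only, standard axioms, no sorries, no definitions.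

A HEAVY DECOMPOSITION of a law `μ` on `{0..M}` at floor `x` and target `T` (as in `…QuantHeavyShift`, inline `∃`) is an exact finite mixture of
two-point components `{lo, hi; γ}` with `x ≤ γ` and credit `2·lo + (hi − lo)·γ ≥ T`; it is DEC at every layer (`decAtT_of_heavy`).  The
average-floor blob lemma (conjecture BLOB-AFL, `…/prim-quant-census-2-g80/TRIPLE-G80.md` §5) asks for such decompositions of `n` equal blobs at their
AVERAGE gate; the zero-only-low lemma (`heavy_of_zeroLow`, `…QuantZeroLowHeavy`) gives them for blob mean `≤ 2`.  This file is the second uniform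
certificate:

* **`heavy_of_reflection`** — for ANY law `μ ≥ 0` on `{0..M}`, a floor `0 ≤ x < 1` and a target `T ≤ x·M`: if every low atom `b` (`2b < T`)
  satisfies the REFLECTION CAPACITY `x·μ b ≤ (1 − x)·μ (M − b)`, then `μ` carries a heavy decomposition at `(x, T)` — the pairs `{b, M − b; x}`
  (weight `μ b/(1−x)`; credit `x·M + 2b(1−x) ≥ T`) and self-sufficient points (two low atoms are never mirror images, since `2b, 2(M−b) < T ≤ M`
  is impossible).  No mean hypothesis.  `decAtT_of_reflection`: DEC at every layer.
Consumers: `…QuantBinomialBlobsHeavy` (n equal blobs with a common gate `g ≥ 1/2`, every `n`), `…QuantThreeBlobsGates` (three blobs, arbitrary gates).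
Census (guidance, memo §3.4): for Poisson-binomial laws at the average gate the reflection capacity holds for EVERY gate vector with all `gᵢ ≥ 1/2`
(3 000 random vectors per `n ≤ 15`, worst ratio `1.000` at all gates `= 1/2`) and for about half of all gate vectors.

HONEST STATUS.  Tool; `SiblingStep`, `FarTreeRow` OPEN; RATE class (log\*) / honest sentence of `run/shared/lean/prim/quant/README.md` unchanged.
[this work].  Nothing here is cited as a published result.  The gluing rows served [cite: KozmaNitzan2024, Conjecture 3 (p. 15)]; product measure
[cite: Grimmett1999, §1.3 p. 10].
-/

noncomputable section

open scoped BigOperators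

namespace Summit.CriticalPhenomena.PercolationContinuityZ3.Theorems
namespace Quant

open Finset

/-- the two-point law `{lo, hi; g}` (as in `…QuantLawDEC`) -/
local notation3 "TP[" lo ", " hi ", " g ", " h "]" =>
  (g : ℝ) * (if (h : ℕ) = (hi : ℕ) then (1 : ℝ) else 0) + (1 - (g : ℝ)) * (if (h : ℕ) = (lo : ℕ) then (1 : ℝ) else 0)

namespace LawDec

/-! ### The reflection certificate -/

/-- **HEAVY BY REFLECTION.**  Let `μ ≥ 0` be a probability law on `{0..M}`, `0 ≤ x < 1` a floor and `T ≤ x·M` a target.  If every low atom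
`b` (`2b < T`) satisfies `x·μ b ≤ (1 − x)·μ (M − b)`, then `μ` is an exact finite mixture of components `{lo, hi; γ}` with `γ ≥ x` and credit
`2·lo + (hi − lo)·γ ≥ T`: the pairs `{b, M−b; x}` of weight `μ b/(1−x)` for the low atoms (credit `x·M + 2b(1−x) ≥ T`) and the points
`h` (`2h ≥ T`) with the leftover weight `μ h − x/(1−x)·μ(M−h)·[M−h low]`. [this work] -/
theorem heavy_of_reflection (M : ℕ) (μ : ℕ → ℝ) (x T : ℝ) (hx0 : 0 ≤ x) (hx1 : x < 1) (hμ0 : ∀ h, 0 ≤ μ h)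
    (hμM : ∀ h, M < h → μ h = 0) (hμ1 : ∑ h ∈ Finset.range (M + 1), μ h = 1) (hTM : T ≤ x * M)
    (hcap : ∀ b : ℕ, 2 * (b : ℝ) < T → x * μ b ≤ (1 - x) * μ (M - b)) :
    ∃ (ι : Type) (_ : Fintype ι) (lam γ : ι → ℝ) (lo hi : ι → ℕ),
      (∀ i, 0 ≤ lam i) ∧ (∑ i, lam i = 1) ∧ (∀ i, 0 ≤ γ i ∧ γ i ≤ 1) ∧ (∀ i, lo i ≤ hi i) ∧ (∀ i, hi i ≤ M) ∧
      (∀ h, μ h = ∑ i, lam i * TP[lo i, hi i, γ i, h]) ∧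
      (∀ i, 0 < lam i → x ≤ γ i ∧ T ≤ 2 * (lo i : ℝ) + ((hi i : ℝ) - lo i) * γ i) := by
  classical
  have h1x : 0 < 1 - x := by linarith
  have hTM' : T ≤ M := hTM.trans (by nlinarith [(Nat.cast_nonneg M : (0 : ℝ) ≤ M)])
  -- two low atoms are never mirror images
  have hnot2 : ∀ b : ℕ, b ≤ M → 2 * (b : ℝ) < T → ¬ 2 * (((M - b : ℕ) : ℝ)) < T := by
    intro b hb h2 h2'
    rw [Nat.cast_sub hb] at h2'
    linarith
  have hlowle : ∀ b : ℕ, 2 * (b : ℝ) < T → 2 * b ≤ M := by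
    intro b h2
    have : (2 * b : ℝ) < M := lt_of_lt_of_le h2 hTM'
    exact_mod_cast this.le
  -- weights: pairs `{b, M-b; x}` on the lows, points elsewhere (less what the mirror low consumed)
  let W : ℕ → ℝ := fun b => if 2 * (b : ℝ) < T then μ b / (1 - x) else 0
  let P : ℕ → ℝ := fun h => if 2 * (((M - h : ℕ) : ℝ)) < T then x / (1 - x) * μ (M - h) else 0
  let V : ℕ → ℝ := fun h => if 2 * (h : ℝ) < T then 0 else μ h - P h
  let LO : ℕ → ℕ := fun b => if 2 * (b : ℝ) < T then b else 0
  let HI : ℕ → ℕ := fun b => if 2 * (b : ℝ) < T then M - b else 0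
  have hW0 : ∀ b, 0 ≤ W b := fun b => by
    simp only [W]; split_ifs
    · exact div_nonneg (hμ0 b) h1x.le
    · exact le_rfl
  have hP0 : ∀ h, 0 ≤ P h := fun h => by
    simp only [P]; split_ifs
    · exact mul_nonneg (div_nonneg hx0 h1x.le) (hμ0 _)
    · exact le_rfl
  have hPle : ∀ h, h ≤ M → P h ≤ μ h := fun h hh => by
    simp only [P]; split_ifs with hl
    · have hc := hcap (M - h) hl
      rw [Nat.sub_sub_self hh] at hc
      rw [div_mul_eq_mul_div, div_le_iff₀ h1x]
      linarith
    · exact hμ0 h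
  have hV0 : ∀ h, h ≤ M → 0 ≤ V h := fun h hh => by
    simp only [V]; split_ifs
    · exact le_rfl
    · linarith [hPle h hh]
  -- a low atom carries no mirror consumption
  have hPlow : ∀ h, h ≤ M → 2 * (h : ℝ) < T → P h = 0 := fun h hh hl => by
    simp only [P]; rw [if_neg (hnot2 h hh hl)]
  -- the law, atom by atom
  have hlaw : ∀ h' : ℕ, μ h' = (∑ b : Fin (M + 1), W (b : ℕ) * TP[LO (b : ℕ), HI (b : ℕ), x, h'])
      + ∑ b : Fin (M + 1), V (b : ℕ) * TP[(b : ℕ), (b : ℕ), (1 : ℝ), h'] := by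
    intro h'
    rw [Fin.sum_univ_eq_sum_range (fun b => W b * TP[LO b, HI b, x, h']) (M + 1),
      Fin.sum_univ_eq_sum_range (fun b => V b * TP[b, b, (1 : ℝ), h']) (M + 1)]
    -- expand the pair terms
    have e1 : ∀ b ∈ Finset.range (M + 1), W b * TP[LO b, HI b, x, h']
        = (if 2 * (b : ℝ) < T then x / (1 - x) * μ b else 0) * (if h' = M - b then (1 : ℝ) else 0)
          + (if 2 * (b : ℝ) < T then μ b else 0) * (if h' = b then (1 : ℝ) else 0) := by
      intro b _
      simp only [W, LO, HI]
      by_cases hl : 2 * (b : ℝ) < T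
      · simp only [if_pos hl]
        field_simp
      · simp only [if_neg hl]; ring
    have e2 : ∀ b : ℕ, V b * TP[b, b, (1 : ℝ), h'] = V b * (if h' = b then (1 : ℝ) else 0) := fun b => by ring
    rw [Finset.sum_congr rfl e1]
    simp_rw [e2]
    rw [Finset.sum_add_distrib, Finset.sum_mul_boole, Finset.sum_mul_boole]
    by_cases hh' : h' ∈ Finset.range (M + 1)
    · have hle : h' ≤ M := Nat.lt_succ_iff.1 (Finset.mem_range.1 hh')
      rw [if_pos hh', if_pos hh']
      -- the mirror sum has the single term `b = M - h'`
      have hmir : ∑ b ∈ Finset.range (M + 1),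
          (if 2 * (b : ℝ) < T then x / (1 - x) * μ b else 0) * (if h' = M - b then (1 : ℝ) else 0) = P h' := by
        have e3 : ∀ b ∈ Finset.range (M + 1),
            (if 2 * (b : ℝ) < T then x / (1 - x) * μ b else 0) * (if h' = M - b then (1 : ℝ) else 0)
              = (if 2 * (b : ℝ) < T then x / (1 - x) * μ b else 0) * (if M - h' = b then (1 : ℝ) else 0) := by
          intro b hb
          have hb' : b ≤ M := Nat.lt_succ_iff.1 (Finset.mem_range.1 hb)
          by_cases hc : h' = M - b
          · rw [if_pos hc, if_pos (show M - h' = b by omega)]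
          · rw [if_neg hc, if_neg (show ¬ (M - h' = b) by omega)]
        have hmem : M - h' ∈ Finset.range (M + 1) := Finset.mem_range.2 (by omega)
        rw [Finset.sum_congr rfl e3, Finset.sum_mul_boole, if_pos hmem]
      rw [hmir]
      simp only [V]
      by_cases hl : 2 * (h' : ℝ) < T
      · rw [if_pos hl, if_pos hl, hPlow h' hle hl]; ring
      · rw [if_neg hl, if_neg hl]; ring
    · have hMh : M < h' := by rw [Finset.mem_range] at hh'; omega
      rw [if_neg hh', if_neg hh', hμM h' hMh]
      have hz : ∑ b ∈ Finset.range (M + 1),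
          (if 2 * (b : ℝ) < T then x / (1 - x) * μ b else 0) * (if h' = M - b then (1 : ℝ) else 0) = 0 :=
        Finset.sum_eq_zero fun b _ => by rw [if_neg (by omega : ¬ h' = M - b), mul_zero]
      rw [hz]; ring
  -- total weight: the mirror consumption re-indexed by `b = M - h`
  have hrefl : ∑ h ∈ Finset.range (M + 1), P h = ∑ b ∈ Finset.range (M + 1), (if 2 * (b : ℝ) < T then x / (1 - x) * μ b else 0) := by
    have h := Finset.sum_range_reflect (fun b : ℕ => if 2 * (b : ℝ) < T then x / (1 - x) * μ b else 0) (M + 1)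
    simp only [Nat.add_sub_cancel] at h
    exact h
  have hsum : ∑ b ∈ Finset.range (M + 1), W b + ∑ h ∈ Finset.range (M + 1), V h = 1 := by
    have eV : ∀ h ∈ Finset.range (M + 1), V h = (if 2 * (h : ℝ) < T then 0 else μ h) - P h := by
      intro h hh
      have hle : h ≤ M := Nat.lt_succ_iff.1 (Finset.mem_range.1 hh)
      simp only [V]
      by_cases hl : 2 * (h : ℝ) < T
      · rw [if_pos hl, if_pos hl, hPlow h hle hl]; ring
      · rw [if_neg hl, if_neg hl]
    rw [Finset.sum_congr rfl eV, Finset.sum_sub_distrib, hrefl, ← Finset.sum_sub_distrib, ← Finset.sum_add_distrib]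
    have eW : ∀ b : ℕ, W b + ((if 2 * (b : ℝ) < T then 0 else μ b) - (if 2 * (b : ℝ) < T then x / (1 - x) * μ b else 0))
        = μ b := by
      intro b
      simp only [W]
      by_cases hl : 2 * (b : ℝ) < T
      · rw [if_pos hl, if_pos hl, if_pos hl]
        field_simp
        ring
      · rw [if_neg hl, if_neg hl, if_neg hl]; ring
    rw [Finset.sum_congr rfl fun b _ => eW b]
    exact hμ1
  -- the decomposition
  refine ⟨Fin (M + 1) ⊕ Fin (M + 1), inferInstance,
    Sum.elim (fun b => W b) (fun h => V h), Sum.elim (fun _ => x) (fun _ => 1),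
    Sum.elim (fun b => LO b) (fun h => (h : ℕ)), Sum.elim (fun b => HI b) (fun h => (h : ℕ)),
    ?_, ?_, ?_, ?_, ?_, fun h' => ?_, ?_⟩
  · rintro (b | h)
    · exact hW0 b
    · exact hV0 h (Nat.lt_succ_iff.1 h.isLt)
  · rw [Fintype.sum_sum_type]
    dsimp only [Sum.elim_inl, Sum.elim_inr]
    rw [Fin.sum_univ_eq_sum_range (fun b => W b) (M + 1), Fin.sum_univ_eq_sum_range (fun h => V h) (M + 1)]
    exact hsum
  · rintro (b | h)
    · exact ⟨hx0, hx1.le⟩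
    · exact ⟨zero_le_one, le_rfl⟩
  · rintro (b | h)
    · show LO b ≤ HI b
      simp only [LO, HI]
      split_ifs with hl
      · have := hlowle b hl; omega
      · exact le_rfl
    · exact le_rfl
  · rintro (b | h)
    · show HI b ≤ M
      simp only [HI]
      split_ifs
      · exact Nat.sub_le M b
      · exact Nat.zero_le M
    · exact Nat.lt_succ_iff.1 h.isLt
  · rw [Fintype.sum_sum_type]
    exact hlaw h'
  · rintro (b | h) hpos
    · simp only [Sum.elim_inl] at hpos ⊢
      have hl : 2 * ((b : ℕ) : ℝ) < T := by
        by_contra hl; simp only [W, if_neg hl] at hpos; exact lt_irrefl _ hpos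
      have hbM : (b : ℕ) ≤ M := Nat.lt_succ_iff.1 b.isLt
      refine ⟨le_rfl, ?_⟩
      show T ≤ 2 * ((LO b : ℕ) : ℝ) + (((HI b : ℕ) : ℝ) - ((LO b : ℕ) : ℝ)) * x
      simp only [LO, HI, if_pos hl]
      rw [Nat.cast_sub hbM]
      have hb0 : (0 : ℝ) ≤ (b : ℕ) := Nat.cast_nonneg _
      nlinarith
    · simp only [Sum.elim_inr] at hpos ⊢
      refine ⟨hx1.le, ?_⟩
      rw [sub_self, zero_mul, add_zero]
      by_contra hlt
      have hl : 2 * ((h : ℕ) : ℝ) < T := not_le.1 hlt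
      simp only [V, if_pos hl] at hpos
      exact lt_irrefl _ hpos

/-- **hence DEC at every layer.** [this work] -/
theorem decAtT_of_reflection (M : ℕ) (μ : ℕ → ℝ) (x T : ℝ) (hx0 : 0 ≤ x) (hx1 : x < 1) (hμ0 : ∀ h, 0 ≤ μ h)
    (hμM : ∀ h, M < h → μ h = 0) (hμ1 : ∑ h ∈ Finset.range (M + 1), μ h = 1) (hTM : T ≤ x * M)
    (hcap : ∀ b : ℕ, 2 * (b : ℝ) < T → x * μ b ≤ (1 - x) * μ (M - b)) (j : ℕ) :
    DECAtT x T j M μ :=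
  decAtT_of_heavy x T M μ (heavy_of_reflection M μ x T hx0 hx1 hμ0 hμM hμ1 hTM hcap) j

end LawDec
end Quant
end Summit.CriticalPhenomena.PercolationContinuityZ3.Theorems
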